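import Literature.RepresentationTheory.KonnoKonno2007.JunctionSqueezeLadder
import Mathlib.Analysis.SpecialFunctions.Trigonometric.DerivHyp
import Mathlib.Analysis.Calculus.SmoothSeries
import Mathlib.Analysis.Calculus.MeanValue
import HarnessLib

/-!
# The squeezed vacuum of the rank-one junction: its Hermite coefficients (kernel, 0 records)

Topic `RepresentationTheory/KonnoKonno2007`; namespace `Literature.RepresentationTheory.KonnoKonno2007.RealDualPair`.
For the real unitary dual pair `U(P,Q) × U(R,S)` with RANK-ONE DEFINITE second factor (`[Unique R] [IsEmpty S]`) and a plane
`(p₀, q₀)`, the hyperbolic implementer family `hypOp R S p₀ q₀ s` (`JunctionHyperbolicFamily`; Konno–Konno 2007 §2–§3, the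
`KAK` middle factor) has generator with Fock matrix `G (B⁻¹F) = B⁻¹ (−i (π z_k z_{k'} + π⁻¹ ∂_k ∂_{k'}) F)`, `k = (p₀,r₀) ∈ V⁺⊗W`,
`k' = (q₀,r₀) ∈ V⁻⊗W` (`hypOpGen_binvPi_frame` of `JunctionHyperbolicFockMatrix`).  With the two-mode ladder of
`JunctionSqueezeLadder` (`d := e_k + e_{k'}`, here `sqStep`) we COMPUTE THE SQUEEZED VACUUM `hypOp s h₀` in the Hermite basis:

      ⟪h_{n d}, hypOp s h₀⟫ = (−i)^n · sech s · tanh^n s,        ⟪h_β, hypOp s h₀⟫ = 0  for β off the ladder `ℕ d`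

(`sqCoeff_nsmul_sqStep`, `sqCoeff_eq_zero_of_ne_nsmul`, packaged `inner_hermiteL2_toL2_hypOp_hermitePi_zero`) — Folland 1989
Prop. (4.39) / (4.24) in the plane, obtained here WITHOUT Gaussian calculus:

* §1 coordinates of the plane (`idxP`, `idxQ`, `sqStep`, ladder weights `cUp`/`cDown`) and the candidate
  `sqB n s = sech s tanh^n s` with its recursion `sqB' n = −((n+1) sqB (n+1) − n sqB (n−1))`·(signs as in `hasDerivAt_sqB`) and
  `Σ_n sqB n s ^ 2 = 1` (`hasSum_sqB_sq`);
* §2 the closed system `T_β ∘ G = −i (√((β_k+1)(β_{k'}+1)) T_{β+d} + √(β_k β_{k'}) T_{β−d})` on `𝓢` (`piCoeffCLM_hypOpGen`, by density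
  from the Fock matrix) and the ODE `a_β' = −i (c⁺_β a_{β+d} + c⁻_β a_{β−d})` for `a_β(s) := ⟪h_β, hypOp s h₀⟫` (`sqCoeff`,
  `hasDerivAt_sqCoeff`, tree `hasDerivAt_apply_hypOp`);
* §3 on the ladder, `Ã_n := i^n a_{nd}` satisfies the REAL recursion of `sqB` (`sqA`, `hasDerivAt_sqA`);
* §4 the ENERGY IDENTITY `Σ_n sqB n s · Ã_n(s) ≡ 1` (termwise differentiation on the window `(s₀−1, s₀+1)` with a Weierstrass
  majorant, `hasDerivAt_tsum_of_isPreconnected`; the derivative telescopes to `0`);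
* §5 CONCLUSION by Bessel: `Σ|Ã_n|² ≤ ‖hypOp s h₀‖² = 1 = Σ sqB²` forces `Ã_n = sqB n` (`sqA_eq_sqB`), and finite Bessel sums over
  `insert β (ladder)` force `a_β = 0` off the ladder.

BOUNDARY.  Everything here is PROVED over the landed junction files; no statement of print is used as a hypothesis and no
record (`def … : Prop`) is introduced; `[cite:]` tags are reader pointers to Folland 1989 / Konno–Konno 2007, not records.

## Main results
* `sqStep`, `nsmul_sqStep_injective`, `sqB`, `hasSum_sqB_sq`, `abs_tanh_lt_one`;
* `piCoeffCLM_hypOpGen`, `sqCoeff`, `hasDerivAt_sqCoeff`, `sqCoeff_zero`;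
* `norm_toL2_hypOp_hermitePi_zero : ‖hypOp s h₀‖_{L²} = 1`;
* `sqCoeff_nsmul_sqStep`, `sqCoeff_eq_zero_of_ne_nsmul`, `inner_hermiteL2_toL2_hypOp_hermitePi_zero`.

## References
* [Folland1989] G. B. Folland, *Harmonic Analysis in Phase Space* (1989), §1.7 (1.82), Prop. (4.39), (4.24).
* [KonnoKonno2007] K. Konno, T. Konno, Kyushu J. Math. 61 (2007) §2–§3.1 (doi:10.2206/kyushujm.61.35) — the junction and its
  `KAK` middle factor; conventions only, nothing cited as a fact.
-/

set_option autoImplicit false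

noncomputable section

open Matrix Complex MeasureTheory Filter MvPolynomial
open scoped Topology Real InnerProductSpace ComplexConjugate BigOperators

namespace Literature.RepresentationTheory.KonnoKonno2007

namespace RealDualPair

open Literature.Analysis.SegalBargmann

local notation "SR" σ => SchwartzMap (σ → ℝ) ℂ
local notation "L2R" σ => Lp ℂ 2 (volume : Measure (σ → ℝ))

/-! ## §1  Coordinates of the plane and the candidate `sech s · tanh^n s` -/

section Plane

variable {P Q : Type*} (R S : Type*) (p₀ : P) (q₀ : Q)

/-- the `V⁺ ⊗ W` coordinate `(p₀, r)`. [folklore] -/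
def idxP (r : R) : DPIdx P Q R S := Sum.inl (Sum.inl (p₀, r))

/-- the `V⁻ ⊗ W` coordinate `(q₀, r)`. [folklore] -/
def idxQ (r : R) : DPIdx P Q R S := Sum.inr (Sum.inr (q₀, r))

/-- the two coordinates of the plane are distinct. [folklore] -/
theorem idxP_ne_idxQ (r : R) : idxP R S p₀ r ≠ idxQ R S q₀ r := by
  simp [idxP, idxQ]

/-- the diagonal step `d = e_{(p₀,r)} + e_{(q₀,r)}`. [folklore] -/
def sqStep (r : R) : DPIdx P Q R S →₀ ℕ :=
  Finsupp.single (idxP R S p₀ r) 1 + Finsupp.single (idxQ R S q₀ r) 1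

/-- raising coefficient `c⁺_β = √((β_{(p₀,r)}+1)(β_{(q₀,r)}+1))`. [folklore] -/
def cUp (r : R) (β : DPIdx P Q R S →₀ ℕ) : ℝ :=
  Real.sqrt ((β (idxP R S p₀ r) + 1) * (β (idxQ R S q₀ r) + 1))

/-- lowering coefficient `c⁻_β = √(β_{(p₀,r)} β_{(q₀,r)})`. [folklore] -/
def cDown (r : R) (β : DPIdx P Q R S →₀ ℕ) : ℝ :=
  Real.sqrt (β (idxP R S p₀ r) * β (idxQ R S q₀ r))

/-- `d_k = 1`. [folklore] -/
theorem sqStep_apply_idxP (r : R) : sqStep R S p₀ q₀ r (idxP R S p₀ r) = 1 := by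
  classical
  rw [sqStep, Finsupp.add_apply, Finsupp.single_eq_same, Finsupp.single_apply,
    if_neg (idxP_ne_idxQ R S p₀ q₀ r).symm, add_zero]

/-- `d_{k'} = 1`. [folklore] -/
theorem sqStep_apply_idxQ (r : R) : sqStep R S p₀ q₀ r (idxQ R S q₀ r) = 1 := by
  classical
  rw [sqStep, Finsupp.add_apply, Finsupp.single_eq_same, Finsupp.single_apply, if_neg (idxP_ne_idxQ R S p₀ q₀ r),
    zero_add]

/-- on the diagonal `c⁺_{n d} = n + 1`. [folklore] -/
theorem cUp_nsmul (r : R) (n : ℕ) : cUp R S p₀ q₀ r (n • sqStep R S p₀ q₀ r) = n + 1 := by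
  rw [cUp, Finsupp.smul_apply, Finsupp.smul_apply, sqStep_apply_idxP, sqStep_apply_idxQ, smul_eq_mul, mul_one,
    Real.sqrt_mul_self (by positivity)]

/-- on the diagonal `c⁻_{n d} = n`. [folklore] -/
theorem cDown_nsmul (r : R) (n : ℕ) : cDown R S p₀ q₀ r (n • sqStep R S p₀ q₀ r) = n := by
  rw [cDown, Finsupp.smul_apply, Finsupp.smul_apply, sqStep_apply_idxP, sqStep_apply_idxQ, smul_eq_mul, mul_one,
    Real.sqrt_mul_self (Nat.cast_nonneg n)]

/-- `n d + d = (n+1) d`. [folklore] -/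
theorem nsmul_sqStep_add (r : R) (n : ℕ) :
    n • sqStep R S p₀ q₀ r + sqStep R S p₀ q₀ r = (n + 1) • sqStep R S p₀ q₀ r :=
  (succ_nsmul _ _).symm

/-- `(n+1) d − d = n d`. [folklore] -/
theorem nsmul_sqStep_sub (r : R) (n : ℕ) :
    n • sqStep R S p₀ q₀ r - sqStep R S p₀ q₀ r = (n - 1) • sqStep R S p₀ q₀ r := by
  ext j
  simp only [Finsupp.tsub_apply, Finsupp.smul_apply, smul_eq_mul, Nat.sub_mul, one_mul]

/-- `n ↦ n d` is injective. [folklore] -/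
theorem nsmul_sqStep_injective (r : R) : Function.Injective fun n : ℕ => n • sqStep R S p₀ q₀ r := fun m n h => by
  have h2 := congrArg (fun γ : DPIdx P Q R S →₀ ℕ => γ (idxP R S p₀ r)) h
  simpa only [Finsupp.smul_apply, sqStep_apply_idxP, smul_eq_mul, mul_one] using h2

/-- `(m+1) d ≠ 0`. [folklore] -/
theorem nsmul_sqStep_ne_zero (r : R) (m : ℕ) : (m + 1) • sqStep R S p₀ q₀ r ≠ 0 := fun h =>
  Nat.succ_ne_zero m (nsmul_sqStep_injective R S p₀ q₀ r (h.trans (zero_smul ℕ (sqStep R S p₀ q₀ r)).symm))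

/-! ### The candidate `B̃_n(s) = sech s · tanh^n s` and its recursion (pure calculus) -/

/-- `B̃_n(s) := sech s · tanh^n s`. [folklore] -/
def sqB (n : ℕ) (s : ℝ) : ℝ := (Real.cosh s)⁻¹ * (Real.sinh s / Real.cosh s) ^ n

/-- `sech² s + tanh² s = 1`. [folklore] -/
theorem sech_sq_add_tanh_sq (s : ℝ) : (Real.cosh s)⁻¹ ^ 2 + (Real.sinh s / Real.cosh s) ^ 2 = 1 := by
  rw [inv_pow, div_pow, inv_eq_one_div, ← add_div, ← Real.cosh_sq',
    div_self (pow_ne_zero 2 (Real.cosh_pos s).ne')]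

/-- `B̃_n' = n B̃_{n−1} − (n+1) B̃_{n+1}` (uses `sech² + tanh² = 1`). [folklore] -/
theorem hasDerivAt_sqB (n : ℕ) (s : ℝ) :
    HasDerivAt (sqB n) ((n : ℝ) * sqB (n - 1) s - ((n : ℝ) + 1) * sqB (n + 1) s) s := by
  have hc : Real.cosh s ≠ 0 := (Real.cosh_pos s).ne'
  have h1 : Real.cosh s * Real.cosh s - Real.sinh s * Real.sinh s = 1 := by
    rw [← sq, ← sq]; exact Real.cosh_sq_sub_sinh_sq s
  have hσ : HasDerivAt (fun y => (Real.cosh y)⁻¹) (-((Real.cosh s)⁻¹ * (Real.sinh s / Real.cosh s))) s := by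
    refine ((Real.hasDerivAt_cosh s).fun_inv hc).congr_deriv ?_
    ring
  have hτ : HasDerivAt (fun y => Real.sinh y / Real.cosh y) ((Real.cosh s)⁻¹ ^ 2) s := by
    refine ((Real.hasDerivAt_sinh s).fun_div (Real.hasDerivAt_cosh s) hc).congr_deriv ?_
    rw [h1, inv_pow, one_div]
  refine (hσ.fun_mul (hτ.fun_pow n)).congr_deriv ?_
  have key := sech_sq_add_tanh_sq s
  simp only [sqB]
  rcases n with _ | m
  · push_cast
    ring
  · simp only [Nat.add_sub_cancel]
    push_cast
    linear_combination (((m : ℝ) + 1) * (Real.cosh s)⁻¹ * (Real.sinh s / Real.cosh s) ^ m) * key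

/-- initial value: `sqB n 0 = δ_{n0}`. [folklore] -/
theorem sqB_zero_right (n : ℕ) : sqB n 0 = if n = 0 then 1 else 0 := by
  rcases n with _ | m
  · simp [sqB]
  · simp [sqB, Real.sinh_zero]

/-- `|sech s tanh^n s| ≤ |tanh s|^n`. [folklore] -/
theorem abs_sqB_le (n : ℕ) (s : ℝ) : |sqB n s| ≤ |Real.sinh s / Real.cosh s| ^ n := by
  rw [sqB, abs_mul, abs_pow, abs_inv, abs_of_pos (Real.cosh_pos s)]
  refine mul_le_of_le_one_left (pow_nonneg (abs_nonneg _) n) ?_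
  exact inv_le_one_of_one_le₀ (Real.one_le_cosh s)

/-- `|tanh s| < 1` (in the `sinh/cosh` spelling used throughout). [folklore] -/
theorem abs_tanh_lt_one (s : ℝ) : |Real.sinh s / Real.cosh s| < 1 := by
  rw [abs_div, abs_of_pos (Real.cosh_pos s), div_lt_one (Real.cosh_pos s), abs_lt]
  refine ⟨?_, Real.sinh_lt_cosh s⟩
  have h := Real.sinh_lt_cosh (-s)
  rw [Real.sinh_neg, Real.cosh_neg] at h
  linarith

/-- `Σ_n B̃_n(s)² = 1` (`sech² · Σ tanh^{2n} = sech² / (1 − tanh²) = 1`). [folklore] -/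
theorem hasSum_sqB_sq (s : ℝ) : HasSum (fun n : ℕ => sqB n s ^ 2) 1 := by
  have ht : (Real.sinh s / Real.cosh s) ^ 2 < 1 := by
    rw [← sq_abs]; exact pow_lt_one₀ (abs_nonneg _) (abs_tanh_lt_one s) two_ne_zero
  have hg := hasSum_geometric_of_lt_one (sq_nonneg (Real.sinh s / Real.cosh s)) ht
  have key := sech_sq_add_tanh_sq s
  have h1 : (1 : ℝ) - (Real.sinh s / Real.cosh s) ^ 2 = (Real.cosh s)⁻¹ ^ 2 := by linarith
  rw [h1] at hg
  have hne : (Real.cosh s)⁻¹ ^ 2 ≠ 0 := pow_ne_zero 2 (inv_ne_zero (Real.cosh_pos s).ne')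
  have h3 := hg.mul_left ((Real.cosh s)⁻¹ ^ 2)
  rw [mul_inv_cancel₀ hne] at h3
  have hfun : (fun n : ℕ => sqB n s ^ 2) = fun n => (Real.cosh s)⁻¹ ^ 2 * ((Real.sinh s / Real.cosh s) ^ 2) ^ n := by
    funext n
    rw [sqB, mul_pow, ← pow_mul, mul_comm n 2, pow_mul]
  rw [hfun]
  exact h3

variable [Fintype P] [DecidableEq P] [Fintype Q] [DecidableEq Q] [Fintype R] [DecidableEq R] [Fintype S]
  [DecidableEq S] [Unique R] [IsEmpty S]

attribute [local instance 10000] InnerProductSpace.toInner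

/-- **rank-one `W`, definite**: the generator has exactly one plane, `G (B⁻¹F) = B⁻¹ (−i (π z_k z_{k'} + π⁻¹∂_k∂_{k'}) F)`.
[cite: Folland1989, Prop (4.39)] -/
theorem hypOpGen_binvPi_rankOne (F : MvPolynomial (DPIdx P Q R S) ℂ) :
    hypOpGen R S p₀ q₀ (binvPi F) =
      binvPi (-(I • hypPairSymb (idxP R S p₀ default) (idxQ R S q₀ default) F)) := by
  rw [hypOpGen_binvPi_frame, Finset.univ_eq_empty, Finset.sum_empty, zero_sub, Fintype.sum_unique, smul_neg]
  rfl

/-- **THE CLOSED SYSTEM on the core**: `T_β (G (B⁻¹F)) = −i (c⁺_β T_{β+d} (B⁻¹F) + c⁻_β T_{β−d} (B⁻¹F))`, through the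
symmetry of the pair symbol and the ladder. [cite: Folland1989, §1.7, (1.82)] -/
theorem piCoeffCLM_hypOpGen_binvPi (β : DPIdx P Q R S →₀ ℕ) (F : MvPolynomial (DPIdx P Q R S) ℂ) :
    piCoeffCLM β (hypOpGen R S p₀ q₀ (binvPi F)) =
      -(I * ((((cUp R S p₀ q₀ default β : ℝ) : ℂ) * piCoeffCLM (β + sqStep R S p₀ q₀ default) (binvPi F) +
        ((cDown R S p₀ q₀ default β : ℝ) : ℂ) * piCoeffCLM (β - sqStep R S p₀ q₀ default) (binvPi F)))) := by
  rw [hypOpGen_binvPi_rankOne, piCoeffCLM_binvPi, piCoeffCLM_binvPi, piCoeffCLM_binvPi, map_neg, map_smul,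
    inner_neg_right (E := FockL2 (DPIdx P Q R S)), inner_smul_right (E := FockL2 (DPIdx P Q R S)),
    inner_fockToL2_hypPairSymb, hypPairSymb_zeta (idxP_ne_idxQ R S p₀ q₀ default), map_add, map_smul, map_smul,
    inner_add_left (E := FockL2 (DPIdx P Q R S)), inner_smul_left (E := FockL2 (DPIdx P Q R S)),
    inner_smul_left (E := FockL2 (DPIdx P Q R S)), Complex.conj_ofReal, Complex.conj_ofReal]
  rfl

/-- **THE CLOSED SYSTEM on `𝓢`**: `T_β (G f) = −i (c⁺_β T_{β+d} f + c⁻_β T_{β−d} f)` for every Schwartz `f`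
(density of the Fock polynomial vectors in `𝓢`). [cite: Folland1989, §1.7, (1.82)] -/
theorem piCoeffCLM_hypOpGen (β : DPIdx P Q R S →₀ ℕ) (f : SR (DPIdx P Q R S)) :
    piCoeffCLM β (hypOpGen R S p₀ q₀ f) =
      -(I * ((((cUp R S p₀ q₀ default β : ℝ) : ℂ) * piCoeffCLM (β + sqStep R S p₀ q₀ default) f +
        ((cDown R S p₀ q₀ default β : ℝ) : ℂ) * piCoeffCLM (β - sqStep R S p₀ q₀ default) f))) := by
  have key := clm_real_eq_of_eq_on_binvPi (σ := DPIdx P Q R S)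
    (S := ((piCoeffCLM β).restrictScalars ℝ).comp (hypOpGen R S p₀ q₀))
    (T := (-(I • ((((cUp R S p₀ q₀ default β : ℝ) : ℂ)) • piCoeffCLM (β + sqStep R S p₀ q₀ default) +
      (((cDown R S p₀ q₀ default β : ℝ) : ℂ)) • piCoeffCLM (β - sqStep R S p₀ q₀ default)))).restrictScalars ℝ)
    (fun F => by
      simp only [ContinuousLinearMap.comp_apply, ContinuousLinearMap.coe_restrictScalars',
        _root_.neg_apply, _root_.smul_apply, _root_.add_apply, smul_eq_mul]
      exact piCoeffCLM_hypOpGen_binvPi R S p₀ q₀ β F)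
  have h2 := congrArg (fun T : (SR (DPIdx P Q R S)) →L[ℝ] ℂ => T f) key
  simpa only [ContinuousLinearMap.comp_apply, ContinuousLinearMap.coe_restrictScalars',
    _root_.neg_apply, _root_.smul_apply, _root_.add_apply, smul_eq_mul]
    using h2

/-! ## §2  The closed system `T_β ∘ G` and the coefficient ODE along the hyperbolic family -/

/-- `a_β(s) := ⟪h_β, hypOp s h₀⟫_{L²}`, the Hermite coefficient `piCoeffCLM β` of the squeezed vacuum
(`piCoeffCLM_hypOp_hermitePi_zero`). [folklore] -/
def sqCoeff (β : DPIdx P Q R S →₀ ℕ) (s : ℝ) : ℂ :=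
  ⟪(hermiteL2 β : L2R (DPIdx P Q R S)), toL2 (hypOp R S p₀ q₀ s (hermitePi 0 : SR (DPIdx P Q R S)))⟫_ℂ

omit [Unique R] [IsEmpty S] in
/-- `piCoeffCLM β (hypOp s h₀) = a_β(s)`. [folklore] -/
theorem piCoeffCLM_hypOp_hermitePi_zero (β : DPIdx P Q R S →₀ ℕ) (s : ℝ) :
    piCoeffCLM β (hypOp R S p₀ q₀ s (hermitePi 0)) = sqCoeff R S p₀ q₀ β s :=
  piCoeffCLM_eq_inner β _

/-- **THE ODE**: `a_β' (s) = −i (c⁺_β a_{β+d}(s) + c⁻_β a_{β−d}(s))`. [cite: Folland1989, (4.24), (1.82)] -/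
theorem hasDerivAt_sqCoeff (β : DPIdx P Q R S →₀ ℕ) (s : ℝ) :
    HasDerivAt (sqCoeff R S p₀ q₀ β)
      (-(I * (((cUp R S p₀ q₀ default β : ℝ) : ℂ) * sqCoeff R S p₀ q₀ (β + sqStep R S p₀ q₀ default) s +
        ((cDown R S p₀ q₀ default β : ℝ) : ℂ) * sqCoeff R S p₀ q₀ (β - sqStep R S p₀ q₀ default) s))) s := by
  have h := hasDerivAt_apply_hypOp R S p₀ q₀ ((piCoeffCLM β).restrictScalars ℝ) (hermitePi 0) s
  rw [ContinuousLinearMap.coe_restrictScalars', piCoeffCLM_hypOpGen] at h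
  simpa only [piCoeffCLM_hypOp_hermitePi_zero] using h

omit [Unique R] [IsEmpty S] in
/-- `a_β(0) = δ_{β0}`. [folklore] -/
theorem sqCoeff_zero (β : DPIdx P Q R S →₀ ℕ) : sqCoeff R S p₀ q₀ β 0 = if β = 0 then 1 else 0 := by
  rw [← piCoeffCLM_hypOp_hermitePi_zero, hypOp_zero, ContinuousLinearMap.coe_id', id, piCoeffCLM_apply,
    piCoeff_hermitePi]

omit [Unique R] [IsEmpty S] in
/-- `|a_β(s)| ≤ 1` (Cauchy–Schwarz; `hypOp s` is unitary and `‖h₀‖ = 1`). [folklore] -/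
theorem norm_sqCoeff_le_one (β : DPIdx P Q R S →₀ ℕ) (s : ℝ) : ‖sqCoeff R S p₀ q₀ β s‖ ≤ 1 := by
  rw [sqCoeff, toL2_hypOp]
  refine (norm_inner_le_norm _ _).trans ?_
  rw [(orthonormal_hermiteL2 (σ := DPIdx P Q R S)).norm_eq_one, one_mul, LinearIsometryEquiv.norm_map,
    toL2_hermitePi, (orthonormal_hermiteL2 (σ := DPIdx P Q R S)).norm_eq_one]

/-! ## §3  The diagonal `β = n • d`: the real three-term recursion for `Ã_n = i^n a_{n d}` -/

/-- `Ã_n(s) := i^n · a_{n•d}(s)`. [folklore] -/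
def sqA (n : ℕ) (s : ℝ) : ℂ := I ^ n * sqCoeff R S p₀ q₀ (n • sqStep R S p₀ q₀ default) s

/-- **`Ã_n' = n Ã_{n−1} − (n+1) Ã_{n+1}`** — the same recursion as `B̃_n`. [cite: Folland1989, (4.24), (1.82)] -/
theorem hasDerivAt_sqA (n : ℕ) (s : ℝ) :
    HasDerivAt (sqA R S p₀ q₀ n)
      ((n : ℂ) * sqA R S p₀ q₀ (n - 1) s - ((n : ℂ) + 1) * sqA R S p₀ q₀ (n + 1) s) s := by
  have h := (hasDerivAt_sqCoeff R S p₀ q₀ (n • sqStep R S p₀ q₀ default) s).const_mul (I ^ n)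
  rw [cUp_nsmul, cDown_nsmul, nsmul_sqStep_add, nsmul_sqStep_sub] at h
  refine h.congr_deriv ?_
  simp only [sqA]
  rcases n with _ | m
  · push_cast
    ring
  · simp only [Nat.add_sub_cancel]
    push_cast
    linear_combination (-((m : ℂ) + 1) * sqCoeff R S p₀ q₀ (m • sqStep R S p₀ q₀ default) s * I ^ m) *
      Complex.I_mul_I

omit [IsEmpty S] in
/-- initial value: `Ã_n(0) = δ_{n0}` (`hypOp 0 = 1`). [folklore] -/
theorem sqA_zero_right (n : ℕ) : sqA R S p₀ q₀ n 0 = if n = 0 then 1 else 0 := by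
  rw [sqA, sqCoeff_zero]
  rcases n with _ | m
  · simp
  · rw [if_neg (nsmul_sqStep_ne_zero R S p₀ q₀ default m), if_neg (Nat.succ_ne_zero m), mul_zero]

omit [IsEmpty S] in
/-- `|Ã_n(s)| ≤ 1` (a Hermite coefficient of a unit vector). [folklore] -/
theorem norm_sqA_le_one (n : ℕ) (s : ℝ) : ‖sqA R S p₀ q₀ n s‖ ≤ 1 := by
  rw [sqA, norm_mul, norm_pow, Complex.norm_I, one_pow, one_mul]
  exact norm_sqCoeff_le_one R S p₀ q₀ _ s

omit [IsEmpty S] in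
/-- the derivative bound `|Ã_n'(s)| ≤ 2n + 1` from the recursion. [folklore] -/
theorem norm_deriv_sqA_le (n : ℕ) (s : ℝ) :
    ‖(n : ℂ) * sqA R S p₀ q₀ (n - 1) s - ((n : ℂ) + 1) * sqA R S p₀ q₀ (n + 1) s‖ ≤ 2 * n + 1 := by
  refine (norm_sub_le _ _).trans ?_
  rw [norm_mul, norm_mul, Complex.norm_natCast, show ((n : ℂ) + 1) = ((n + 1 : ℕ) : ℂ) by push_cast; ring,
    Complex.norm_natCast]
  have h1 := norm_sqA_le_one R S p₀ q₀ (n - 1) s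
  have h2 := norm_sqA_le_one R S p₀ q₀ (n + 1) s
  push_cast
  nlinarith [norm_nonneg (sqA R S p₀ q₀ (n - 1) s), norm_nonneg (sqA R S p₀ q₀ (n + 1) s)]

/-! ## §4  The energy identity `Σ_n B̃_n(s) Ã_n(s) = 1` -/

/-- `u_n(s) := B̃_n(s) Ã_n(s)`. [folklore] -/
def sqU (n : ℕ) (s : ℝ) : ℂ := (sqB n s : ℂ) * sqA R S p₀ q₀ n s

/-- `u_n'(s)`. [folklore] -/
def sqU' (n : ℕ) (s : ℝ) : ℂ :=
  (((n : ℝ) * sqB (n - 1) s - ((n : ℝ) + 1) * sqB (n + 1) s : ℝ) : ℂ) * sqA R S p₀ q₀ n s +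
    (sqB n s : ℂ) * ((n : ℂ) * sqA R S p₀ q₀ (n - 1) s - ((n : ℂ) + 1) * sqA R S p₀ q₀ (n + 1) s)

/-- the summand `u_n = sqB n · Ã_n` of the energy series is differentiable with derivative `sqU'`. [folklore] -/
theorem hasDerivAt_sqU (n : ℕ) (s : ℝ) : HasDerivAt (sqU R S p₀ q₀ n) (sqU' R S p₀ q₀ n s) s :=
  ((hasDerivAt_sqB n s).ofReal_comp).fun_mul (hasDerivAt_sqA R S p₀ q₀ n s)

omit [Fintype P] [DecidableEq P] [Fintype Q] [DecidableEq Q] [Fintype R] [DecidableEq R] [Fintype S]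
  [DecidableEq S] [Unique R] [IsEmpty S] in
/-- `|sqB n y| ≤ T^n` when `|tanh y| ≤ T`. [folklore] -/
theorem norm_ofReal_sqB_le {T y : ℝ} (hT : |Real.sinh y / Real.cosh y| ≤ T) (n : ℕ) :
    ‖(sqB n y : ℂ)‖ ≤ T ^ n := by
  rw [Complex.norm_real, Real.norm_eq_abs]
  exact (abs_sqB_le n y).trans (pow_le_pow_left₀ (abs_nonneg _) hT n)

omit [Fintype P] [DecidableEq P] [Fintype Q] [DecidableEq Q] [Fintype R] [DecidableEq R] [Fintype S]
  [DecidableEq S] [Unique R] [IsEmpty S] in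
/-- `|sqB' n y| ≤ (2n+1) T^{n-1}`-type bound when `|tanh y| ≤ T ≤ 1`. [folklore] -/
theorem norm_ofReal_deriv_sqB_le {T y : ℝ} (hT : |Real.sinh y / Real.cosh y| ≤ T) (hT1 : T ≤ 1) (n : ℕ) :
    ‖(((n : ℝ) * sqB (n - 1) y - ((n : ℝ) + 1) * sqB (n + 1) y : ℝ) : ℂ)‖ ≤ (2 * n + 1) * T ^ (n - 1) := by
  have hT0 : 0 ≤ T := (abs_nonneg _).trans hT
  rw [Complex.norm_real, Real.norm_eq_abs]
  refine (abs_sub _ _).trans ?_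
  rw [abs_mul, abs_mul, Nat.abs_cast, abs_of_nonneg (by positivity : (0:ℝ) ≤ n + 1)]
  have h1 := (abs_sqB_le (n - 1) y).trans (pow_le_pow_left₀ (abs_nonneg _) hT (n - 1))
  have h2 := (abs_sqB_le (n + 1) y).trans (pow_le_pow_left₀ (abs_nonneg _) hT (n + 1))
  have h3 : T ^ (n + 1) ≤ T ^ (n - 1) := pow_le_pow_of_le_one hT0 hT1 (by omega)
  have h4 := add_le_add (mul_le_mul_of_nonneg_left h1 (Nat.cast_nonneg n))
    (mul_le_mul_of_nonneg_left (h2.trans h3) (by positivity : (0:ℝ) ≤ n + 1))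
  linarith

omit [IsEmpty S] in
/-- the Weierstrass majorant of the differentiated energy series on `{|tanh| ≤ T}`. [folklore] -/
theorem norm_sqU'_le {T y : ℝ} (hT : |Real.sinh y / Real.cosh y| ≤ T) (hT1 : T ≤ 1) (n : ℕ) :
    ‖sqU' R S p₀ q₀ n y‖ ≤ (4 * n + 2) * T ^ (n - 1) := by
  have hT0 : 0 ≤ T := (abs_nonneg _).trans hT
  have h1 := norm_ofReal_deriv_sqB_le hT hT1 n
  have h2 := norm_sqA_le_one R S p₀ q₀ n y
  have h3 := norm_ofReal_sqB_le hT n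
  have h4 := norm_deriv_sqA_le R S p₀ q₀ n y
  have h5 : T ^ n ≤ T ^ (n - 1) := pow_le_pow_of_le_one hT0 hT1 (Nat.sub_le n 1)
  refine (norm_add_le _ _).trans ?_
  rw [norm_mul, norm_mul]
  have h6 := add_le_add (mul_le_mul h1 h2 (norm_nonneg _) (by positivity))
    (mul_le_mul (h3.trans h5) h4 (norm_nonneg _) (by positivity))
  linarith

omit [Fintype P] [DecidableEq P] [Fintype Q] [DecidableEq Q] [Fintype R] [DecidableEq R] [Fintype S]
  [DecidableEq S] [Unique R] [IsEmpty S] in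
/-- the majorant `Σ_n (4n+2) T^{n-1}`-type series is summable for `0 ≤ T < 1`. [folklore] -/
theorem summable_majorant {T : ℝ} (hT0 : 0 ≤ T) (hT1 : T < 1) :
    Summable fun n : ℕ => (4 * (n : ℝ) + 2) * T ^ (n - 1) := by
  refine (summable_nat_add_iff 1).mp ?_
  have h1 := summable_pow_mul_geometric_of_norm_lt_one 1
    (show ‖T‖ < 1 by rwa [Real.norm_eq_abs, abs_of_nonneg hT0])
  have h2 := summable_geometric_of_lt_one hT0 hT1
  refine ((h1.mul_left 4).add (h2.mul_left 6)).congr fun m => ?_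
  simp only [Nat.add_sub_cancel, pow_one]
  push_cast
  ring

omit [Fintype P] [DecidableEq P] [Fintype Q] [DecidableEq Q] [Fintype R] [DecidableEq R] [Fintype S]
  [DecidableEq S] [Unique R] [IsEmpty S] in
/-- `y ↦ sinh y / cosh y` is continuous. [folklore] -/
theorem continuous_tanhQuot : Continuous fun y : ℝ => Real.sinh y / Real.cosh y :=
  Real.continuous_sinh.div Real.continuous_cosh fun y => (Real.cosh_pos y).ne'

omit [Fintype P] [DecidableEq P] [Fintype Q] [DecidableEq Q] [Fintype R] [DecidableEq R] [Fintype S]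
  [DecidableEq S] [Unique R] [IsEmpty S] in
/-- on `[s₀−1, s₀+1]` the modulus of `tanh` stays below some `T < 1`. [folklore] -/
theorem exists_abs_tanh_le (s₀ : ℝ) :
    ∃ T : ℝ, 0 ≤ T ∧ T < 1 ∧ ∀ y ∈ Set.Icc (s₀ - 1) (s₀ + 1), |Real.sinh y / Real.cosh y| ≤ T := by
  obtain ⟨y₀, -, hmax⟩ := (isCompact_Icc : IsCompact (Set.Icc (s₀ - 1) (s₀ + 1))).exists_isMaxOn
    (Set.nonempty_Icc.mpr (by linarith)) (continuous_abs.comp continuous_tanhQuot).continuousOn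
  exact ⟨_, abs_nonneg _, abs_tanh_lt_one y₀, fun y hy => isMaxOn_iff.mp hmax y hy⟩

omit [IsEmpty S] in
/-- the energy series `Σ_n sqB n s · Ã_n(s)` is summable. [folklore] -/
theorem summable_sqU (s : ℝ) : Summable fun n => sqU R S p₀ q₀ n s := by
  refine Summable.of_norm_bounded (summable_geometric_of_lt_one (abs_nonneg _) (abs_tanh_lt_one s)) fun n => ?_
  rw [sqU, norm_mul]
  have h := mul_le_mul (norm_ofReal_sqB_le (le_refl |Real.sinh s / Real.cosh s|) n) (norm_sqA_le_one R S p₀ q₀ n s)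
    (norm_nonneg _) (pow_nonneg (abs_nonneg _) n)
  linarith

/-- term-by-term differentiation of `Σ_n u_n`. [folklore] -/
theorem hasDerivAt_tsum_sqU (s₀ : ℝ) :
    HasDerivAt (fun s => ∑' n, sqU R S p₀ q₀ n s) (∑' n, sqU' R S p₀ q₀ n s₀) s₀ := by
  obtain ⟨T, hT0, hT1, hT⟩ := exists_abs_tanh_le s₀
  have hmem : s₀ ∈ Set.Ioo (s₀ - 1) (s₀ + 1) := ⟨by linarith, by linarith⟩
  exact hasDerivAt_tsum_of_isPreconnected (summable_majorant hT0 hT1) isOpen_Ioo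
    (convex_Ioo (s₀ - 1) (s₀ + 1)).isPreconnected (fun n y _ => hasDerivAt_sqU R S p₀ q₀ n y)
    (fun n y hy => norm_sqU'_le R S p₀ q₀ (hT y (Set.Ioo_subset_Icc_self hy)) hT1.le n) hmem
    (summable_sqU R S p₀ q₀ s₀) hmem

omit [IsEmpty S] in
/-- **the derivative series telescopes to zero**: `Σ_n u_n' = Σ (X_n − X_{n+1}) + Σ (Y_n − Y_{n+1}) = 0` with
`X_n = n B̃_{n−1} Ã_n`, `Y_n = n B̃_n Ã_{n−1}` (both absolutely summable, `X_0 = Y_0 = 0`). [folklore] -/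
theorem tsum_sqU'_eq_zero (s : ℝ) : ∑' n, sqU' R S p₀ q₀ n s = 0 := by
  have ht := abs_tanh_lt_one s
  have hbn : ∀ n, ‖(sqB n s : ℂ)‖ ≤ |Real.sinh s / Real.cosh s| ^ n := fun n => norm_ofReal_sqB_le le_rfl n
  have han : ∀ n, ‖sqA R S p₀ q₀ n s‖ ≤ 1 := fun n => norm_sqA_le_one R S p₀ q₀ n s
  have hg1 : Summable fun n : ℕ => (n : ℝ) * |Real.sinh s / Real.cosh s| ^ n := by
    simpa only [pow_one] using summable_pow_mul_geometric_of_norm_lt_one 1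
      (show ‖|Real.sinh s / Real.cosh s|‖ < 1 by rwa [Real.norm_eq_abs, abs_abs])
  have hg0 := summable_geometric_of_lt_one (abs_nonneg _) ht
  -- `X_n := n B̃_{n-1} Ã_n`, `Y_n := n B̃_n Ã_{n-1}`
  set X : ℕ → ℂ := fun n => (n : ℂ) * (sqB (n - 1) s : ℂ) * sqA R S p₀ q₀ n s with hXdef
  set Y : ℕ → ℂ := fun n => (n : ℂ) * (sqB n s : ℂ) * sqA R S p₀ q₀ (n - 1) s with hYdef
  have hX : Summable X := by
    refine (summable_nat_add_iff 1).mp (Summable.of_norm_bounded (hg1.add hg0) fun m => ?_)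
    simp only [hXdef, Nat.add_sub_cancel]
    rw [norm_mul, norm_mul, Complex.norm_natCast]
    have h := mul_le_mul (hbn m) (han (m + 1)) (norm_nonneg _) (pow_nonneg (abs_nonneg _) m)
    have hm : (0 : ℝ) ≤ (m + 1 : ℕ) := Nat.cast_nonneg _
    have h' := mul_le_mul_of_nonneg_left h hm
    push_cast at h' ⊢
    nlinarith [h', pow_nonneg (abs_nonneg (Real.sinh s / Real.cosh s)) m]
  have hY : Summable Y := by
    refine Summable.of_norm_bounded hg1 fun n => ?_
    simp only [hYdef]
    rw [norm_mul, norm_mul, Complex.norm_natCast, mul_assoc]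
    exact mul_le_mul_of_nonneg_left ((mul_le_mul (hbn n) (han (n - 1)) (norm_nonneg _)
      (pow_nonneg (abs_nonneg _) n)).trans (mul_one _).le) (Nat.cast_nonneg n)
  have hX0 : X 0 = 0 := by simp [hXdef]
  have hY0 : Y 0 = 0 := by simp [hYdef]
  have hX1 := (hasSum_nat_add_iff' 1).mpr hX.hasSum
  have hY1 := (hasSum_nat_add_iff' 1).mpr hY.hasSum
  rw [Finset.sum_range_one] at hX1 hY1
  have hsum := (hX.hasSum.sub hX1).add (hY.hasSum.sub hY1)
  rw [hX0, hY0] at hsum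
  have hfun : (fun n => sqU' R S p₀ q₀ n s) = fun n => X n - X (n + 1) + (Y n - Y (n + 1)) := by
    funext n
    simp only [sqU', hXdef, hYdef, Nat.add_sub_cancel]
    push_cast
    ring
  rw [hfun, hsum.tsum_eq]
  ring

/-- **ENERGY IDENTITY**: `Σ_n B̃_n(s) Ã_n(s) = 1` for all `s` (derivative zero, value `1` at `s = 0`). [folklore] -/
theorem tsum_sqU_eq_one (s : ℝ) : ∑' n, sqU R S p₀ q₀ n s = 1 := by
  have hF : ∀ x, HasDerivAt (fun s => ∑' n, sqU R S p₀ q₀ n s) 0 x := fun x => by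
    simpa only [tsum_sqU'_eq_zero] using hasDerivAt_tsum_sqU R S p₀ q₀ x
  rw [is_const_of_deriv_eq_zero (fun x => (hF x).differentiableAt) (fun x => (hF x).deriv) s 0]
  refine (tsum_eq_single 0 fun n hn => ?_).trans ?_
  · rw [sqU, sqA_zero_right, if_neg hn, mul_zero]
  · rw [sqU, sqA_zero_right, sqB_zero_right, if_pos rfl, if_pos rfl, Complex.ofReal_one, mul_one]

/-! ## §5  Conclusion: `Ã_n = B̃_n` (Bessel + the energy identity + `Σ B̃_n² = 1`) -/

/-- real part of the energy identity: `Σ_n sqB n s · Re Ã_n(s) = 1`. [folklore] -/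
theorem hasSum_sqB_mul_re_sqA (s : ℝ) : HasSum (fun n => sqB n s * (sqA R S p₀ q₀ n s).re) 1 := by
  have h := Complex.hasSum_re (summable_sqU R S p₀ q₀ s).hasSum
  rw [tsum_sqU_eq_one, Complex.one_re] at h
  have e : (fun n => (sqU R S p₀ q₀ n s).re) = fun n => sqB n s * (sqA R S p₀ q₀ n s).re := by
    funext n
    simp [sqU, Complex.mul_re]
  rw [e] at h
  exact h

omit [Unique R] [IsEmpty S] in
/-- **the squeezed vacuum is a unit vector**: `‖hypOp s h₀‖_{L²} = 1` (`hypOp s` has a unitary `L²` lift).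
[cite: Folland1989, (1.82)] -/
theorem norm_toL2_hypOp_hermitePi_zero (s : ℝ) :
    ‖toL2 (hypOp R S p₀ q₀ s (hermitePi 0 : SR (DPIdx P Q R S)))‖ = 1 := by
  rw [toL2_hypOp, LinearIsometryEquiv.norm_map, toL2_hermitePi,
    (orthonormal_hermiteL2 (σ := DPIdx P Q R S)).norm_eq_one]

omit [IsEmpty S] in
/-- Bessel along the diagonal: `Σ_n |Ã_n(s)|² ≤ 1`. [folklore] -/
theorem exists_hasSum_norm_sqA_sq (s : ℝ) : ∃ A : ℝ, A ≤ 1 ∧ HasSum (fun n => ‖sqA R S p₀ q₀ n s‖ ^ 2) A := by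
  set ψ := toL2 (hypOp R S p₀ q₀ s (hermitePi 0 : SR (DPIdx P Q R S))) with hψdef
  have hv := (orthonormal_hermiteL2 (σ := DPIdx P Q R S)).comp _ (nsmul_sqStep_injective R S p₀ q₀ default)
  have e : ∀ n, ‖⟪((fun β => (hermiteL2 β : L2R (DPIdx P Q R S))) ∘ fun n : ℕ => n • sqStep R S p₀ q₀ default) n,
      ψ⟫_ℂ‖ ^ 2 = ‖sqA R S p₀ q₀ n s‖ ^ 2 := fun n => by
    rw [sqA, norm_mul, norm_pow, Complex.norm_I, one_pow, one_mul]
    rfl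
  refine ⟨∑' n, ‖sqA R S p₀ q₀ n s‖ ^ 2, ?_, ((hv.inner_products_summable ψ).congr e).hasSum⟩
  have hB := hv.tsum_inner_products_le ψ
  rw [norm_toL2_hypOp_hermitePi_zero, one_pow, tsum_congr e] at hB
  exact hB

/-- **`Ã_n(s) = B̃_n(s)`**: `0 ≤ Σ_m |Ã_m − B̃_m|² = Σ|Ã_m|² − 2 Re Σ B̃_m Ã_m + Σ B̃_m² ≤ 1 − 2 + 1 = 0`.
[folklore] -/
theorem sqA_eq_sqB (n : ℕ) (s : ℝ) : sqA R S p₀ q₀ n s = (sqB n s : ℂ) := by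
  obtain ⟨A, hA1, hA⟩ := exists_hasSum_norm_sqA_sq R S p₀ q₀ s
  have hsum := (hA.sub ((hasSum_sqB_mul_re_sqA R S p₀ q₀ s).mul_left 2)).add (hasSum_sqB_sq s)
  have hnn : ∀ m, ‖sqA R S p₀ q₀ m s‖ ^ 2 - 2 * (sqB m s * (sqA R S p₀ q₀ m s).re) + sqB m s ^ 2 =
      ‖sqA R S p₀ q₀ m s - sqB m s‖ ^ 2 := fun m => by
    rw [Complex.sq_norm, Complex.sq_norm, Complex.normSq_apply, Complex.normSq_apply, Complex.sub_re, Complex.sub_im,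
      Complex.ofReal_re, Complex.ofReal_im]
    ring
  simp only [hnn] at hsum
  have hle := le_hasSum hsum n fun j _ => sq_nonneg _
  have h0 : ‖sqA R S p₀ q₀ n s - sqB n s‖ ^ 2 ≤ 0 := hle.trans (by linarith)
  have h00 : ‖sqA R S p₀ q₀ n s - sqB n s‖ = 0 := by
    nlinarith [norm_nonneg (sqA R S p₀ q₀ n s - sqB n s)]
  rwa [norm_eq_zero, sub_eq_zero] at h00

/-! ## §6  THE HERMITE COEFFICIENTS OF THE SQUEEZED VACUUM -/

/-- **DIAGONAL**: `⟪h_{n d}, hypOp s h₀⟫ = (−i)^n sech s tanh^n s`, `d = e_{(p₀,r₀)} + e_{(q₀,r₀)}`.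
[cite: Folland1989, Prop (4.39), (1.82)] -/
theorem sqCoeff_nsmul_sqStep (n : ℕ) (s : ℝ) :
    sqCoeff R S p₀ q₀ (n • sqStep R S p₀ q₀ default) s =
      (-I) ^ n * (((Real.cosh s)⁻¹ * (Real.sinh s / Real.cosh s) ^ n : ℝ) : ℂ) := by
  have h := sqA_eq_sqB R S p₀ q₀ n s
  rw [sqA, sqB] at h
  have hI : (-I) ^ n * I ^ n = 1 := by rw [← mul_pow, neg_mul, Complex.I_mul_I, neg_neg, one_pow]
  rw [← h, ← mul_assoc, hI, one_mul]

/-- **OFF-DIAGONAL**: `⟪h_β, hypOp s h₀⟫ = 0` unless `β ∈ ℕ d`. [cite: Folland1989, Prop (4.39), (1.82)] -/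
theorem sqCoeff_eq_zero_of_ne_nsmul (β : DPIdx P Q R S →₀ ℕ) (hβ : ∀ n : ℕ, β ≠ n • sqStep R S p₀ q₀ default)
    (s : ℝ) : sqCoeff R S p₀ q₀ β s = 0 := by
  set ψ := toL2 (hypOp R S p₀ q₀ s (hermitePi 0 : SR (DPIdx P Q R S))) with hψdef
  let ι : Option ℕ → (DPIdx P Q R S →₀ ℕ) := fun o => o.elim β fun n => n • sqStep R S p₀ q₀ default
  have hι : Function.Injective ι := by
    rintro (_ | m) (_ | m') h
    · rfl
    · exact absurd (by simpa [ι] using h) (hβ m')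
    · exact absurd (by simpa [ι] using h.symm) (hβ m)
    · simp only [ι, Option.elim_some] at h
      rw [nsmul_sqStep_injective R S p₀ q₀ default h]
  have hv := (orthonormal_hermiteL2 (σ := DPIdx P Q R S)).comp ι hι
  have e0 : ‖⟪((fun β => (hermiteL2 β : L2R (DPIdx P Q R S))) ∘ ι) none, ψ⟫_ℂ‖ ^ 2 =
      ‖sqCoeff R S p₀ q₀ β s‖ ^ 2 := rfl
  have e1 : ∀ n : ℕ, ‖⟪((fun β => (hermiteL2 β : L2R (DPIdx P Q R S))) ∘ ι) (some n), ψ⟫_ℂ‖ ^ 2 = sqB n s ^ 2 :=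
      fun n => by
    change ‖sqCoeff R S p₀ q₀ (n • sqStep R S p₀ q₀ default) s‖ ^ 2 = _
    rw [sqCoeff_nsmul_sqStep, norm_mul, norm_pow, norm_neg, Complex.norm_I, one_pow, one_mul, Complex.norm_real,
      Real.norm_eq_abs, sq_abs, sqB]
  have hle : ∀ N : ℕ, ‖sqCoeff R S p₀ q₀ β s‖ ^ 2 + ∑ n ∈ Finset.range N, sqB n s ^ 2 ≤ 1 := fun N => by
    have h := hv.sum_inner_products_le ψ (s := Finset.insertNone (Finset.range N))
    rw [Finset.sum_insertNone, norm_toL2_hypOp_hermitePi_zero, one_pow, e0] at h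
    simp only [e1] at h
    exact h
  have hlim : Tendsto (fun N => ‖sqCoeff R S p₀ q₀ β s‖ ^ 2 + ∑ n ∈ Finset.range N, sqB n s ^ 2) atTop
      (𝓝 (‖sqCoeff R S p₀ q₀ β s‖ ^ 2 + 1)) := tendsto_const_nhds.add (hasSum_sqB_sq s).tendsto_sum_nat
  have h1 : ‖sqCoeff R S p₀ q₀ β s‖ ^ 2 + 1 ≤ 1 := le_of_tendsto' hlim hle
  have h2 : ‖sqCoeff R S p₀ q₀ β s‖ = 0 := by nlinarith [norm_nonneg (sqCoeff R S p₀ q₀ β s)]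
  exact norm_eq_zero.mp h2

open Classical in
/-- **THE HERMITE EXPANSION OF THE SQUEEZED VACUUM, inner-product form**: for every multi-index `β`,
`⟪h_β, hypOp s h₀⟫_{L²} = (−i)^n sech s tanh^n s` if `β = n d`, and `0` otherwise. [cite: Folland1989, Prop (4.39), (1.82)] -/
theorem inner_hermiteL2_toL2_hypOp_hermitePi_zero (β : DPIdx P Q R S →₀ ℕ) (s : ℝ) :
    ⟪(hermiteL2 β : L2R (DPIdx P Q R S)), toL2 (hypOp R S p₀ q₀ s (hermitePi 0))⟫_ℂ =
      if h : ∃ n : ℕ, β = n • sqStep R S p₀ q₀ default then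
        (-I) ^ h.choose * (((Real.cosh s)⁻¹ * (Real.sinh s / Real.cosh s) ^ h.choose : ℝ) : ℂ)
      else 0 := by
  change sqCoeff R S p₀ q₀ β s = _
  split_ifs with h
  · conv_lhs => rw [h.choose_spec]
    exact sqCoeff_nsmul_sqStep R S p₀ q₀ h.choose s
  · simp only [not_exists] at h
    exact sqCoeff_eq_zero_of_ne_nsmul R S p₀ q₀ β h s

end Plane

end RealDualPair

end Literature.RepresentationTheory.KonnoKonno2007
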